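import Summits.QuantumFields.YangMills.Theorems.LuscherReductionDressedRitzOfExcitedPlateau
import Summits.QuantumFields.YangMills.Theorems.LuscherReductionOneSiteLevelsClosed
import HarnessLib

/-!
# Route `LuscherReduction`, item `DressedRitz` (stmt-QuantumFields-20205) — reduction chain, file 5: NON-VACUITY CERTIFICATES of the generator cuts —
# `RunningReduction → OneSiteLevels → ∀ k, ExcitedPlateauAt k` (hence `DiagonalPlateauAt`, `RitzGeneratorsAt`), and ONE-free since crux ONE is closed

Support module of the `FemtoTransferGap` group (fleet service by seat ym-infvol-p2 g6; route `LuscherReduction`, femto rung R2b1; bears on the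
crux child `DressedRitz` = stmt-QuantumFields-20205 of RED `RunningReduction` stmt-QuantumFields-19978).  CONTENT = §8 and §10 of the planner's
crux workfile `Summits/QuantumFields/YangMills/Cruxes/RunningReduction/Lines/DressedRitzGEVP.lean` (rev 3, sha16 8eae6de8b30412fb, seat
ym-cruxidea-19978-1 GEN 5; kernel-checked there) RE-HOMED on the Theorems side (cuts ↦ `∀ k`, their `k`-slices of `…DressedRitzPlateauDefs.lean`;
proofs VERBATIM), plus the ONE-free corollaries available since crux ONE `OneSiteLevels` (stmt-QuantumFields-20007) is CLOSED in the tree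
(`FemtoTransferGap.oneSiteLevels_proof`, 2026-08-27T07:09Z).

WHY: a typed cut handed to provers must be certified not over-strong.  Witnesses: the exact physical `l2`-orthonormal eigenfamily `K_βφ_j = λ_jφ_j`,
`j ≤ k` (`PhysL2.exists_isPhys_eigenfamily`; `λ_k > 0` deep in the window by `levelValue_pos_of_red_one`), `Ω := φ₀`, `w_i := φ_{i+1}`.  Then
(x2), (x3), (x4), (x6) hold with value `0`; (x1) is `levelValue_antitone`; (x5) IS RED at levels `1 … k` (`runningReduction_uniform`); (x7) is
`λ₀ − λ_{i+1} ≤ λ₀ − λ_k ≤ C'(λ/L)λ₀` (`spread_le_of_red_one` from the LOWER laws of RED ∧ ONE).  So `RED (∧ ONE) ⟹ ∀ k, ExcitedPlateauAt k ⟹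
∀ k, DiagonalPlateauAt k ⟹ ∀ k, RitzGeneratorsAt k ⟺ DressedRitz`: every cut of the chain is implied by the parent crux — satisfiable exactly when
RED holds, neither vacuous nor over-strong (complements the tree's `KTRCertificateRed.dressedRitz_of_runningReduction_unconditional`).

* §8 `oneSiteCoupling_ge_of_small_level` (threshold bookkeeping), `spread_le_of_red_one` (pure real).
* §10 ★★ `excitedPlateau_of_runningReduction_oneSiteLevels : RunningReduction → OneSiteLevels → ∀ k, ExcitedPlateauAt k`;
  `diagonalPlateau_of_runningReduction_oneSiteLevels`, `ritzGenerators_of_runningReduction_oneSiteLevels`.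
* §10b (ONE closed) ★ `excitedPlateau_of_runningReduction : RunningReduction → ∀ k, ExcitedPlateauAt k`, `diagonalPlateau_of_runningReduction`,
  `ritzGenerators_of_runningReduction`.
Operator-language certificates (`RunningReduction → ∀ k, OperatorPlateauAt k`): companion `…DressedRitzOperatorPlateauCertificates.lean`.

HONEST FRAMING: fixed-lattice Rayleigh–Ritz bookkeeping on the femto rung R2b1; proves nothing OF RED ∕ `DressedRitz`; no bearing on infinite volume,
the continuum limit or the Clay mass gap.  References: Reed–Simon IV, Thm. XIII.1 [cite: ReedSimonIV1978, Thm. XIII.1]; M. Lüscher, NPB 219 (1983)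
233 [cite: Luscher1983, §3].
-/

set_option autoImplicit false

noncomputable section

open MeasureTheory Filter Topology Real
open Literature.MathematicalPhysics.QuantumFieldTheory
open Literature.MathematicalPhysics.QuantumLattice
open Literature.Analysis.OperatorTheory.YMMatrixModel
open Literature.Analysis.OperatorTheory
open scoped BigOperators

namespace Summit.QuantumFields.YangMills.Theorems.FemtoTransferGap.KTGen

open Summit.QuantumFields.YangMills.Theorems.FemtoTransferGap
open Summit.QuantumFields.YangMills.Theorems.FemtoTransferGap.KTRCalibration
open Summit.QuantumFields.YangMills.Theorems.FemtoTransferGap.PhysL2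

/-! ## §8 Threshold bookkeeping and the pure-real spread lemma (for the certificates of §10) -/

/-- In the femto window, a small level `lam ≤ 1/(4·max B₀ 1)` puts the effective one-site coupling beyond any threshold `B₀`:
`B(β,L) ≥ 1/(4 lam³) ≥ 1/(4 lam) ≥ max B₀ 1`. (The computation inside `KTRCalibration.levelValue_pos_of_red_one`, exported.) [folklore] -/
theorem oneSiteCoupling_ge_of_small_level {B0 lam β : ℝ} {L : ℕ} [NeZero L] (hlam : 0 < lam) (hlam1 : lam ≤ 1)
    (hlamB : lam ≤ 1 / (4 * max B0 1)) (hW : InFemtoWindow lam β L) : B0 ≤ oneSiteCoupling β L := by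
  have hB1 : 1 / (4 * lam ^ 3) ≤ oneSiteCoupling β L := oneSiteCoupling_ge_of_window hlam hW
  have hM1 : (1 : ℝ) ≤ max B0 1 := le_max_right _ _
  have hM0 : 0 < max B0 1 := zero_lt_one.trans_le hM1
  have hlam3 : lam ^ 3 ≤ lam := by
    have h1 : lam ^ 3 = lam * (lam * lam) := by ring
    rw [h1]
    have h2 : lam * lam ≤ 1 := by nlinarith
    nlinarith
  have h1 : max B0 1 ≤ 1 / (4 * lam) := by
    rw [le_div_iff₀ (by positivity)]
    have := (le_div_iff₀ (by positivity : (0 : ℝ) < 4 * max B0 1)).mp hlamB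
    linarith
  have h2 : 1 / (4 * lam) ≤ 1 / (4 * lam ^ 3) :=
    one_div_le_one_div_of_le (by positivity) (by linarith)
  exact (le_max_left B0 1).trans (h1.trans (h2.trans hB1))

/-- **Relative spread from RED's and ONE's lower laws (pure real).**  If `μ₀ > 0`, `λ₀ ≥ 0`, `0 ≤ s ≤ 1 ≤ r`,
`e^{−(D(s/r) + C₁(s/r)²)}μ₀ ≤ μ_k` (ONE from below at `λ_b = s/r`) and `μ_kλ₀ ≤ e^{Cs²/r}λ_kμ₀` (RED from below), then
`λ₀ − λ_k ≤ (|C| + |D| + |C₁|)(s/r)λ₀` — via `λ_k ≥ e^{−x}λ₀`, `x = Cs·(s/r) + D(s/r) + C₁(s/r)²`, and `1 − e^{−x} ≤ x ≤ (|C|+|D|+|C₁|)(s/r)`. [folklore] -/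
theorem spread_le_of_red_one {l0 lk m0 mk C D C1 s r : ℝ}
    (hm0 : 0 < m0) (hl0 : 0 ≤ l0) (hs0 : 0 ≤ s) (hs1 : s ≤ 1) (hr : 1 ≤ r)
    (hONE : Real.exp (-(D * (s / r) + C1 * (s / r) ^ 2)) * m0 ≤ mk)
    (hRED : mk * l0 ≤ Real.exp (C * s ^ 2 / r) * (lk * m0)) :
    l0 - lk ≤ (|C| + |D| + |C1|) * (s / r) * l0 := by
  have hr0 : 0 < r := one_pos.trans_le hr
  have ht0 : 0 ≤ s / r := div_nonneg hs0 hr0.le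
  have ht1 : s / r ≤ 1 := by
    rw [div_le_one hr0]
    exact hs1.trans hr
  have hCs : C * s ^ 2 / r = C * s * (s / r) := by ring
  rw [hCs] at hRED
  -- step 1: chain the two lower laws and cancel `μ₀ > 0`
  have h1 : Real.exp (-(D * (s / r) + C1 * (s / r) ^ 2)) * m0 * l0 ≤ Real.exp (C * s * (s / r)) * (lk * m0) :=
    (mul_le_mul_of_nonneg_right hONE hl0).trans hRED
  have h2 : Real.exp (-(D * (s / r) + C1 * (s / r) ^ 2)) * l0 ≤ Real.exp (C * s * (s / r)) * lk := by
    have h1' : m0 * (Real.exp (-(D * (s / r) + C1 * (s / r) ^ 2)) * l0) ≤ m0 * (Real.exp (C * s * (s / r)) * lk) := by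
      calc m0 * (Real.exp (-(D * (s / r) + C1 * (s / r) ^ 2)) * l0)
          = Real.exp (-(D * (s / r) + C1 * (s / r) ^ 2)) * m0 * l0 := by ring
        _ ≤ Real.exp (C * s * (s / r)) * (lk * m0) := h1
        _ = m0 * (Real.exp (C * s * (s / r)) * lk) := by ring
    exact le_of_mul_le_mul_left h1' hm0
  -- step 2: `λ_k ≥ e^{−x} λ₀`
  have h3 : Real.exp (-(C * s * (s / r) + (D * (s / r) + C1 * (s / r) ^ 2))) * l0 ≤ lk := by
    have hpos : 0 ≤ Real.exp (-(C * s * (s / r))) := (Real.exp_pos _).le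
    have h := mul_le_mul_of_nonneg_left h2 hpos
    have e1 : Real.exp (-(C * s * (s / r))) * (Real.exp (-(D * (s / r) + C1 * (s / r) ^ 2)) * l0)
        = Real.exp (-(C * s * (s / r) + (D * (s / r) + C1 * (s / r) ^ 2))) * l0 := by
      rw [← mul_assoc, ← Real.exp_add]
      congr 1
      congr 1
      ring
    have e2 : Real.exp (-(C * s * (s / r))) * (Real.exp (C * s * (s / r)) * lk) = lk := by
      rw [← mul_assoc, ← Real.exp_add, neg_add_cancel, Real.exp_zero, one_mul]
    rw [e1, e2] at h
    exact h
  -- step 3: `1 − e^{−x} ≤ x`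
  have h4 : l0 - lk ≤ l0 * (C * s * (s / r) + (D * (s / r) + C1 * (s / r) ^ 2)) := by
    have hex : 1 - (C * s * (s / r) + (D * (s / r) + C1 * (s / r) ^ 2))
        ≤ Real.exp (-(C * s * (s / r) + (D * (s / r) + C1 * (s / r) ^ 2))) := by
      linarith [Real.add_one_le_exp (-(C * s * (s / r) + (D * (s / r) + C1 * (s / r) ^ 2)))]
    have h5 := mul_le_mul_of_nonneg_left hex hl0
    nlinarith [h5, h3]
  -- step 4: `x ≤ (|C| + |D| + |C₁|)(s/r)`
  have h6 : C * s * (s / r) + (D * (s / r) + C1 * (s / r) ^ 2) ≤ (|C| + |D| + |C1|) * (s / r) := by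
    have a1 : C * s * (s / r) ≤ |C| * (s / r) := by
      have : C * s ≤ |C| := by
        calc C * s ≤ |C| * s := mul_le_mul_of_nonneg_right (le_abs_self C) hs0
          _ ≤ |C| * 1 := mul_le_mul_of_nonneg_left hs1 (abs_nonneg C)
          _ = |C| := mul_one _
      exact mul_le_mul_of_nonneg_right this ht0
    have a2 : D * (s / r) ≤ |D| * (s / r) := mul_le_mul_of_nonneg_right (le_abs_self D) ht0
    have a3 : C1 * (s / r) ^ 2 ≤ |C1| * (s / r) := by
      have hsq : (s / r) ^ 2 ≤ s / r := by nlinarith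
      calc C1 * (s / r) ^ 2 ≤ |C1| * (s / r) ^ 2 := mul_le_mul_of_nonneg_right (le_abs_self C1) (sq_nonneg _)
        _ ≤ |C1| * (s / r) := mul_le_mul_of_nonneg_left hsq (abs_nonneg C1)
    linarith
  calc l0 - lk ≤ l0 * (C * s * (s / r) + (D * (s / r) + C1 * (s / r) ^ 2)) := h4
    _ ≤ l0 * ((|C| + |D| + |C1|) * (s / r)) := mul_le_mul_of_nonneg_left h6 hl0
    _ = (|C| + |D| + |C1|) * (s / r) * l0 := by ring

/-! ## §10 NON-VACUITY CERTIFICATES: `RunningReduction → OneSiteLevels → ∀ k, ExcitedPlateauAt k (→ DiagonalPlateauAt k → RitzGeneratorsAt k)` -/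

/-- ★★ **NON-VACUITY CERTIFICATE for the excited-sector cut: `RunningReduction → OneSiteLevels → ∀ k, ExcitedPlateauAt k`.**  Witnesses: the exact
physical `l2`-orthonormal eigenfamily `K_βφ_j = λ_jφ_j`, `j ≤ k` (`PhysL2.exists_isPhys_eigenfamily`; `λ_k > 0` deep in the window by
`levelValue_pos_of_red_one`), `Ω := φ₀`, `w_i := φ_{i+1}`.  Then (x2), (x3), (x4), (x6) hold with value `0`; (x1) is `levelValue_antitone`; (x5) IS RED
at levels `1 … k` (`runningReduction_uniform`); (x7) is `λ₀ − λ_{i+1} ≤ λ₀ − λ_k ≤ C'(λ/L)λ₀` (`spread_le_of_red_one` from the LOWER laws of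
RED ∧ ONE, `λ ≤ 2·lam ≤ 1 ≤ L`).  One constant `C' := |C_RED| + |Δ_k| + |C_ONE|`, `lam0' := min lam0_RED (min (1/2) (1/(4·max B₀ 1)))`.  So the cut is
implied by the route's two cruxes: satisfiable exactly when they hold, not over-strong. [cite: ReedSimonIV1978, Thm. XIII.1] [cite: Luscher1983, §3] -/
theorem excitedPlateau_of_runningReduction_oneSiteLevels
    (hRED : Summit.QuantumFields.YangMills.Theses.LuscherReduction.RunningReduction)
    (hONE : Summit.QuantumFields.YangMills.Theses.LuscherReduction.OneSiteLevels) :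
    ∀ k : ℕ, ExcitedPlateauAt k := by
  intro k
  obtain ⟨C, lam0, hlam0, hC⟩ := runningReduction_uniform hRED k
  obtain ⟨Ck, B0, hB0⟩ := hONE k
  have hCC' : C ≤ |C| + |levelGap k| + |Ck| := by
    linarith [le_abs_self C, abs_nonneg (levelGap k), abs_nonneg Ck]
  have hC'0 : 0 ≤ |C| + |levelGap k| + |Ck| := by positivity
  refine ⟨|C| + |levelGap k| + |Ck|, min lam0 (min (1 / 2) (1 / (4 * max B0 1))),
    lt_min hlam0 (lt_min (by norm_num) (by positivity)), fun lam hlam hle => ?_⟩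
  obtain ⟨L0, hL⟩ := hC lam hlam (hle.trans (min_le_left _ _))
  refine ⟨L0, fun L _ hL0 β hW => ?_⟩
  have hlam_half : lam ≤ 1 / 2 := (hle.trans (min_le_right _ _)).trans (min_le_left _ _)
  have hlam1 : lam ≤ 1 := hlam_half.trans (by norm_num)
  have hlamB : lam ≤ 1 / (4 * max B0 1) := (hle.trans (min_le_right _ _)).trans (min_le_right _ _)
  have hβ : (0 : ℝ) ≤ β := zero_le_one.trans hW.1
  have hB : 0 ≤ oneSiteCoupling β L := oneSiteCoupling_nonneg β L
  have hlam_nn : 0 ≤ luscherLambda β L := luscherLambda_nonneg β L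
  have hlpos : 0 < luscherLambda β L := luscherLambda_pos_of_window hlam hW
  have hΛ1 : luscherLambda β L ≤ 1 := by linarith [hW.2.2]
  have hL1 : (1 : ℝ) ≤ (L : ℝ) := by exact_mod_cast NeZero.one_le
  have hLnn : (0 : ℝ) ≤ (L : ℝ) := Nat.cast_nonneg L
  have ht1 : 0 ≤ luscherLambda β L / L := div_nonneg hlam_nn hLnn
  have ht2 : 0 ≤ luscherLambda β L ^ 2 / L := div_nonneg (sq_nonneg _) hLnn
  have ht3 : 0 ≤ luscherLambda β L ^ 3 / (L : ℝ) ^ 2 := div_nonneg (pow_nonneg hlam_nn 3) (sq_nonneg _)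
  have hlv0 : 0 ≤ levelValue su2Rep L β 0 := levelValue_su2Rep_nonneg L hβ 0
  -- positivity of `λ_k`, then spectral attainment of the levels `0 … k`
  have hk : 0 < levelValue su2Rep L β k :=
    levelValue_pos_of_red_one hlam hlam1 hlamB hW (fun B hB => ⟨(hB0 B hB).1, (hB0 B hB).2.2⟩)
      (hL L hL0 β hW k le_rfl).2
  obtain ⟨φ, hφ, hon, heig⟩ := exists_isPhys_eigenfamily hβ k hk
  have hritz : ∀ i : Fin (k + 1), qform su2Rep β (φ i) (φ i) = levelValue su2Rep L β i := ritz_of_eigen hon heig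
  -- the level-`k` spread from the lower laws of RED ∧ ONE, and monotonicity of the levels
  have hsp : levelValue su2Rep L β 0 - levelValue su2Rep L β k
      ≤ (|C| + |levelGap k| + |Ck|) * (luscherLambda β L / L) * levelValue su2Rep L β 0 := by
    have hB0le : B0 ≤ oneSiteCoupling β L := oneSiteCoupling_ge_of_small_level hlam hlam1 hlamB hW
    obtain ⟨hμ0, -, hlow⟩ := hB0 _ hB0le
    rw [bareLambda_oneSiteCoupling hlpos] at hlow
    exact spread_le_of_red_one hμ0 hlv0 hlam_nn hΛ1 hL1 hlow (hL L hL0 β hW k le_rfl).2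
  have hsucc_le : ∀ i : Fin k, (i : ℕ) + 1 ≤ k := fun i => Nat.succ_le_of_lt i.2
  refine ⟨fun i => φ i.succ, fun i => hφ i.succ, fun i => ?_, fun i l hil => ?_, fun i l hil => ?_,
    ⟨φ 0, hφ 0, ?_, ?_, fun i => ?_⟩, fun i => ?_, fun i => ?_, fun i l hil => ?_, fun i => ?_⟩
  · -- unit norm
    rw [hon i.succ i.succ, if_pos rfl]
  · -- (x1) sorted diagonal values
    rw [hritz, hritz]
    exact levelValue_antitone hβ (Fin.le_def.mp (Fin.succ_le_succ_iff.mpr hil))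
  · -- (x2) near-orthogonality, here exact
    rw [hon i.succ l.succ, if_neg (fun h => hil (Fin.succ_injective _ h)), abs_zero]
    exact mul_nonneg hC'0 hlam_nn
  · -- (x3) the vacuum `Ω := φ₀`: unit norm
    rw [hon 0 0, if_pos rfl]
  · -- (x3) eigen-equation at level `0`
    rw [heig 0, Fin.val_zero]
  · -- (x3) vacuum overlaps, here exact zero
    rw [hon 0 i.succ, if_neg (Fin.succ_ne_zero i).symm, abs_zero]
    exact mul_nonneg hC'0 hlam_nn
  · -- (x4) one-step residual, here zero
    have hz : transferApply β (φ i.succ) - qform su2Rep β (φ i.succ) (φ i.succ) • φ i.succ = 0 := by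
      rw [heig i.succ, hritz i.succ, sub_self]
    rw [hz, l2_zero_zero]
    exact mul_nonneg (mul_nonneg hC'0 ht3) (sq_nonneg _)
  · -- (x5) Lüscher position against `λ₀` = RED at level `i+1 ≤ k`
    rw [hritz i.succ, Fin.val_succ]
    obtain ⟨ha, hb⟩ := hL L hL0 β hW ((i : ℕ) + 1) (hsucc_le i)
    have hY₁ : 0 ≤ levelValue su2Rep 1 (oneSiteCoupling β L) ((i : ℕ) + 1) * levelValue su2Rep L β 0 :=
      mul_nonneg (levelValue_su2Rep_nonneg 1 hB _) hlv0
    have hY₂ : 0 ≤ levelValue su2Rep L β ((i : ℕ) + 1) * levelValue su2Rep 1 (oneSiteCoupling β L) 0 :=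
      mul_nonneg (levelValue_su2Rep_nonneg L hβ _) (levelValue_su2Rep_nonneg 1 hB 0)
    exact ⟨le_exp_mul_div_of_le ha ht2 hY₁ hCC', le_exp_mul_div_of_le hb ht2 hY₂ hCC'⟩
  · -- (x6) symmetrised excited couplings, here zero
    have hne : i.succ ≠ l.succ := fun h => hil (Fin.succ_injective _ h)
    rw [qform_of_eigen_orthonormal hon heig i.succ l.succ, if_neg hne, hon i.succ l.succ, if_neg hne, mul_zero, sub_zero,
      abs_zero]
    exact mul_nonneg (mul_nonneg hC'0 ht2) hlv0
  · -- (x7) spread at level `i+1 ≤ k`: `λ₀ − λ_{i+1} ≤ λ₀ − λ_k`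
    rw [hritz i.succ, Fin.val_succ]
    have hmono : levelValue su2Rep L β k ≤ levelValue su2Rep L β ((i : ℕ) + 1) := levelValue_antitone hβ (hsucc_le i)
    linarith

/-- Corollary: **`RunningReduction → OneSiteLevels → ∀ k, DiagonalPlateauAt k`** through the excited cut.
[cite: ReedSimonIV1978, Thm. XIII.1] -/
theorem diagonalPlateau_of_runningReduction_oneSiteLevels
    (hRED : Summit.QuantumFields.YangMills.Theses.LuscherReduction.RunningReduction)
    (hONE : Summit.QuantumFields.YangMills.Theses.LuscherReduction.OneSiteLevels) :
    ∀ k : ℕ, DiagonalPlateauAt k :=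
  fun k => diagonalPlateauAt_of_excitedPlateauAt (excitedPlateau_of_runningReduction_oneSiteLevels hRED hONE k)

/-- Corollary: `RunningReduction → OneSiteLevels → ∀ k, RitzGeneratorsAt k` through the SAME cuts (re-deriving the tree's
`KTRCertificate.dressedRitz_of_runningReduction_oneSiteLevels` via `ExcitedPlateauAt → DiagonalPlateauAt → RitzGeneratorsAt → DressedRitzAt`).
[cite: ReedSimonIV1978, Thm. XIII.1] -/
theorem ritzGenerators_of_runningReduction_oneSiteLevels
    (hRED : Summit.QuantumFields.YangMills.Theses.LuscherReduction.RunningReduction)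
    (hONE : Summit.QuantumFields.YangMills.Theses.LuscherReduction.OneSiteLevels) :
    ∀ k : ℕ, RitzGeneratorsAt k :=
  fun k => ritzGeneratorsAt_of_diagonalPlateauAt (diagonalPlateau_of_runningReduction_oneSiteLevels hRED hONE k)

/-! ## §10b ONE-free certificates (crux ONE `OneSiteLevels`, stmt-QuantumFields-20007, is CLOSED: `oneSiteLevels_proof`) -/

/-- ★ **`RunningReduction → ∀ k, ExcitedPlateauAt k`** — the excited-sector cut is implied by RED ALONE (ONE discharged by the tree's
`oneSiteLevels_proof`). [cite: ReedSimonIV1978, Thm. XIII.1] -/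
theorem excitedPlateau_of_runningReduction
    (hRED : Summit.QuantumFields.YangMills.Theses.LuscherReduction.RunningReduction) : ∀ k : ℕ, ExcitedPlateauAt k :=
  excitedPlateau_of_runningReduction_oneSiteLevels hRED oneSiteLevels_proof

/-- `RunningReduction → ∀ k, DiagonalPlateauAt k` (ONE discharged). [cite: ReedSimonIV1978, Thm. XIII.1] -/
theorem diagonalPlateau_of_runningReduction
    (hRED : Summit.QuantumFields.YangMills.Theses.LuscherReduction.RunningReduction) : ∀ k : ℕ, DiagonalPlateauAt k :=
  fun k => diagonalPlateauAt_of_excitedPlateauAt (excitedPlateau_of_runningReduction hRED k)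

/-- `RunningReduction → ∀ k, RitzGeneratorsAt k` (ONE discharged). [cite: ReedSimonIV1978, Thm. XIII.1] -/
theorem ritzGenerators_of_runningReduction
    (hRED : Summit.QuantumFields.YangMills.Theses.LuscherReduction.RunningReduction) : ∀ k : ℕ, RitzGeneratorsAt k :=
  fun k => ritzGeneratorsAt_of_excitedPlateauAt (excitedPlateau_of_runningReduction hRED k)

end Summit.QuantumFields.YangMills.Theorems.FemtoTransferGap.KTGen

end
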